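/-
Copyright (c) 2026 the pub-hodgecm-mathlib formalisation cell (harness21).  Prover seat hodgecm-mathlib-LH4-p02 (g5), 2026-09-02: (B)(ii)+(iii) of LH4-plan (g5) WORD #24 — the
ADDITIVE index of the conductor orders and of the valuation balls at a ramified CM place, by transport to ★ `AdicCompletionBallLatticeIndex` (wild base layer of the (D-RAM) column).
-/
import Literature.NumberTheory.Automorphic.RamifiedPlaceOrderUnitIndex     -- ★ p851113 LH4-p01 (g4) MARS: `eq_of_toPlace_add_toPlace_mul_eq`, `exp_neg_sq`; brings ★ σ-DEPTH `valued_galAdicCompletionMap_sub_self_le_sq_mul_iff`, ★ basis, `natCard_residueField_valuativeRel_eq`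
import Literature.NumberTheory.LocalFields.AdicCompletionBallLatticeIndex    -- ★ LA5-p02 (g3): `exists_addSubgroup_ball`, `relIndex_ball_eq_pow` (`[B(e) : B(e+k)] = q^{Σ k}` in `F_vⁿ`)
import HarnessLib

/-!
# ADDITIVE indices at a ramified CM place: `[𝔭_w^m : 𝔭_w^{m+k}] = q_v^k`, `[𝒪_w^# : 𝒪_w] = q_v^d`, and the additive Mars index `[𝒪_w : 𝒪_v + ϖ_v^j 𝒪_w] = q_v^j`
# (Serre, *Local Fields* II §3 Prop. 5, III §3; Neukirch I §12; Flicker 1998 Prop. 7 — any residue characteristic)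

Topic `NumberTheory/Automorphic`; namespace `Literature.NumberTheory.Automorphic.UnitaryGroup`.  THEOREMS ONLY (no definition, no instance, no notation, no named fact,
no `sorry`; axioms ⊆ {propext, Classical.choice, Quot.sound}).  Cell `pub/hodgecm-mathlib` (D-0151), crux H413 = `stmt-HodgeConjecture-24833`; half A line LH4, DYADIC
pay-down leaf `Cruxes/H413/Lines/F0_P3c_DyadicPaydown.lean`, organ (D-RAM) (PRINT by ruling D74′; scope audit LH4-plan (g5) b4c7662647f1db69 «COVERED at v ∣ 2»).  HONEST
READER LABEL: BANKED base layer, consumers none live — pieces (ii)+(iii) of the trace-dual index `[O_j^# : O_j] = q_v^{d+2j}` (LH4-plan (g5) WORD #24 (B)); HC_CM is proved only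
modulo the 7 printed citations (2 remaining named inputs: hLiu418 = stmt-HodgeConjecture-24832, h413 = stmt-HodgeConjecture-24833) until rung 0 closes; count-neutral.

SETTING (= ★ `RamifiedPlaceDifferent` ∕ ★ MARS `RamifiedPlaceOrderUnitIndex`).  `L` CM, `w ∣ v` with `c • w = w`, `e(w|v) ≠ 1`; `F := L⁺_v`, `E := L_w`, `ι = toPlace v w`,
`σ = σ_w`, `τ` a uniformiser, `D = |στ − τ| = exp(−d)`; `q_v = #(𝓞_{L⁺} ∕ v) = #𝓀(L⁺_v) = #𝓀(L_w)` (`f(w|v) = 1`).  Additive subgroups of `L_w` are HYPOTHESIS-CHARACTERISED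
(no definitions): `𝒪_w = {|x| ≤ 1}`, balls `{|x| ≤ exp(−m)}`, the conductor-`j` order `O_j = {|x| ≤ 1, |σx − x| ≤ exp(−2j)·D}` (= `𝒪_v + ϖ_v^j 𝒪_w` by ★ σ-DEPTH
`valued_galAdicCompletionMap_sub_self_le_iff_mem_order` — the SAME letter as MARS's `V_j` without the unit condition), the trace dual `𝒪_w^# = {|y|·D ≤ 1}` (★
`RamifiedPlaceTraceDual` §3 ∕ ★ `QuadraticLocalTracePlace` §4).  NO NEW COUNTING: every index below is ★ `relIndex_ball_eq_pow` (`[B(e) : B(e+k)] = q^{Σ k}` in `F_vⁿ`)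
transported along an additive hom by Mathlib `AddSubgroup.relIndex_comap` — `n = 1` over `L_w` itself for the balls, `n = 2` over `L⁺_v` through the Eisenstein coordinates
`(a, b) ↦ ι a + ι b · τ` (onto ★ `exists_eq_toPlace_add_toPlace_mul`, one-to-one ★ MARS `eq_of_toPlace_add_toPlace_mul_eq`) for the order.
* §1 existence: `exists_addSubgroup_valued_le (c)` (balls), `exists_addSubgroup_order (c)` (σ-depth orders), `exists_addSubgroup_valued_mul_le (D)` (trace duals).
* §2 BALLS: private `natCard_quotient_placesOver_eq_of_ramified` (`q_w = q_v`, `f = 1`: ★ `Liu2021…inertiaDeg_eq_one_of_ne_one` + Mathlib `Ideal.absNorm_pow_inertiaDeg` — the 6-line proof of ★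
  `Rogawski1990.RankOneUnstableDeltaValueRamified.absNorm_placesOver_eq_of_ramified`, kept private to spare that import); **`relIndex_valued_le_eq_pow (m : ℤ) (k : ℕ)`**:
  `[𝔭_w^m : 𝔭_w^{m+k}] = q_v^k`; **`relIndex_integer_traceDual_eq_pow`**: `[𝒪_w^# : 𝒪_w] = q_v^d` for `D = exp(−d)` (the different number read as an index — Serre III §3:
  `N(𝔇) = [𝒪_w^# : 𝒪_w]`).
* §3 THE ADDITIVE MARS INDEX **`relIndex_order_eq_pow (hτ) (j) (Λ O)`**: `[𝒪_w : 𝒪_v + ϖ_v^j 𝒪_w] = q_v^j` (`𝒪_w ∕ O_j ≅ 𝒪_v τ ∕ ϖ_v^j 𝒪_v τ`), + the `𝓀[L⁺_v]` reading; the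
  MULTIPLICATIVE index `[𝒪_wˣ : O_jˣ] = q_v^j` is ★ MARS `relIndex_eq_pow_of_sigmaDepth` (same `q^j` because `f = 1` kills Neukirch's factor `(1 − 1∕q_w·…)`: here a remark only).

## References
* [Serre1979] J.-P. Serre, *Local Fields*, GTM 67 (1979): Ch. II §3 Prop. 5 (`[𝔪^i : 𝔪^{i+1}] = q`), Ch. III §3 (codifferent, `N𝔇`), Ch. IV §1.
* [NeukirchANT1999] J. Neukirch, *Algebraic Number Theory* (1999): Ch. I §12 (orders `𝒪 + 𝔣𝒪_K`, conductor, `[𝒪_K : 𝒪]`), Ch. III §2.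
* [Flicker1998UnitaryFL] Y. Z. Flicker, *Elementary proof of the fundamental lemma for a unitary group*, Canad. J. Math. 50 (1998), Prop. 7 p. 84 (the orders `R + π^j R_E`).
-/

set_option autoImplicit false

noncomputable section

open NumberField IsDedekindDomain ValuativeRel
open scoped ValuativeRel WithZero

namespace Literature.NumberTheory.Automorphic.UnitaryGroup

open Literature.NumberTheory.LocalFields (exists_addSubgroup_ball relIndex_ball_eq_pow)

variable (L : Type) [Field L] [NumberField L] [IsCMField L] (v : HeightOneSpectrum (𝓞 ↥(maximalRealSubfield L)))
  (w : PlacesOver L v) (hw : IsCMField.complexConj L • w.1 = w.1) (he : v.asIdeal.ramificationIdx' w.1.asIdeal ≠ 1)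

/-! ## §1 The subgroups exist (hypothesis-characterised, no definitions) -/

omit [IsCMField L] in
/-- **VALUATION BALLS ARE ADDITIVE SUBGROUPS of `L_w`**: for any `c ∈ ℤᵐ⁰`, `∃ B, x ∈ B ↔ |x| ≤ c` (`c = 1`: `𝒪_w`; `c = exp(−m)`: `𝔭_w^m`). [cite: Serre1979, Ch. II §3] -/
theorem exists_addSubgroup_valued_le (c : WithZero (Multiplicative ℤ)) :
    ∃ B : AddSubgroup (w.1.adicCompletion L), ∀ x, x ∈ B ↔ Valued.v x ≤ c := by
  refine ⟨{ carrier := setOf fun x : w.1.adicCompletion L => Valued.v x ≤ c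
            add_mem' := fun {a b} ha hb => (Valued.v.map_add a b).trans (max_le ha hb)
            zero_mem' := by simp
            neg_mem' := fun {a} ha => by rw [Set.mem_setOf_eq, Valuation.map_neg]; exact ha }, fun x => Iff.rfl⟩

/-- **THE σ-DEPTH ORDERS ARE ADDITIVE SUBGROUPS**: for any `c`, `∃ O, x ∈ O ↔ |x| ≤ 1 ∧ |σx − x| ≤ c` (`c = exp(−2j)·D`: the conductor-`j` order `𝒪_v + ϖ_v^j 𝒪_w`, ★ σ-DEPTH §3).
[cite: NeukirchANT1999, Ch. I §12] [cite: Flicker1998UnitaryFL, Prop. 7 p. 84] -/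
theorem exists_addSubgroup_order (c : WithZero (Multiplicative ℤ)) :
    ∃ O : AddSubgroup (w.1.adicCompletion L), ∀ x, x ∈ O ↔ Valued.v x ≤ 1 ∧
      Valued.v (galAdicCompletionMap (L := L) (IsCMField.complexConj L) hw x - x) ≤ c := by
  refine ⟨{ carrier := setOf fun x : w.1.adicCompletion L => Valued.v x ≤ 1 ∧ Valued.v (galAdicCompletionMap (L := L) (IsCMField.complexConj L) hw x - x) ≤ c
            add_mem' := fun {a b} ha hb => ⟨(Valued.v.map_add a b).trans (max_le ha.1 hb.1), ?_⟩
            zero_mem' := ?_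
            neg_mem' := fun {a} ha => ⟨by rw [Valuation.map_neg]; exact ha.1, ?_⟩ }, fun x => Iff.rfl⟩
  · rw [map_add, show galAdicCompletionMap (L := L) (IsCMField.complexConj L) hw a + galAdicCompletionMap (L := L) (IsCMField.complexConj L) hw b - (a + b) =
        (galAdicCompletionMap (L := L) (IsCMField.complexConj L) hw a - a) + (galAdicCompletionMap (L := L) (IsCMField.complexConj L) hw b - b) by ring]
    exact (Valued.v.map_add _ _).trans (max_le ha.2 hb.2)
  · refine ⟨by simp, ?_⟩
    rw [map_zero, sub_zero, map_zero]; exact zero_le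
  · rw [map_neg, show -galAdicCompletionMap (L := L) (IsCMField.complexConj L) hw a - -a = -(galAdicCompletionMap (L := L) (IsCMField.complexConj L) hw a - a) by ring,
      Valuation.map_neg]
    exact ha.2

omit [IsCMField L] in
/-- **THE TRACE-DUAL BALL `{|y| · D ≤ 1}` IS AN ADDITIVE SUBGROUP** (for any `D ∈ ℤᵐ⁰`; `D = |στ − τ|`: `𝒪_w^# = 𝔭_w^{−d}`, ★ `RamifiedPlaceTraceDual` §3). [cite: Serre1979, Ch. III §3] -/
theorem exists_addSubgroup_valued_mul_le (D : WithZero (Multiplicative ℤ)) :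
    ∃ B : AddSubgroup (w.1.adicCompletion L), ∀ y, y ∈ B ↔ Valued.v y * D ≤ 1 := by
  refine ⟨{ carrier := setOf fun y : w.1.adicCompletion L => Valued.v y * D ≤ 1
            add_mem' := fun {a b} ha hb => ?_
            zero_mem' := by simp
            neg_mem' := fun {a} ha => by rw [Set.mem_setOf_eq, Valuation.map_neg]; exact ha }, fun x => Iff.rfl⟩
  change Valued.v (a + b) * D ≤ 1
  rcases le_total (Valued.v a) (Valued.v b) with hab | hab
  · calc Valued.v (a + b) * D ≤ Valued.v b * D := by gcongr; exact (Valued.v.map_add a b).trans (max_le hab le_rfl)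
      _ ≤ 1 := hb
  · calc Valued.v (a + b) * D ≤ Valued.v a * D := by gcongr; exact (Valued.v.map_add a b).trans (max_le le_rfl hab)
      _ ≤ 1 := ha

/-! ## §2 Balls in `L_w`: `[𝔭_w^m : 𝔭_w^{m+k}] = q_v^k` and `[𝒪_w^# : 𝒪_w] = q_v^d` -/

include hw he in
/-- `#(𝓞_L ∕ 𝔓_w) = #(𝓞_{L⁺} ∕ v)` at a RAMIFIED non-split place (`f(w|v) = 1`, ★ `Liu2021…inertiaDeg_eq_one_of_ne_one`; Mathlib `Ideal.absNorm_pow_inertiaDeg`) — private twin of ★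
`Rogawski1990.RankOneUnstableDeltaValueRamified.absNorm_placesOver_eq_of_ramified` ∕ ★ `UnitaryGroupIntegralPointsReductionRamified.natCard_residueField_eq_of_ramified`.
[cite: NeukirchANT1999, Ch. I §8 Prop. 8.2] -/
private theorem natCard_quotient_placesOver_eq_of_ramified :
    Nat.card (𝓞 L ⧸ w.1.asIdeal) = Nat.card (𝓞 ↥(maximalRealSubfield L) ⧸ v.asIdeal) := by
  haveI := PlacesOver.liesOver (E := L) w
  have h := Ideal.absNorm_pow_inertiaDeg v.asIdeal w.1.asIdeal
  rw [Liu2021.LemD1IndexedNonVacuityRamifiedPlace.inertiaDeg_eq_one_of_ne_one L v (IsCMField.complexConj L) (IsCMField.complexConj_ne_one L) w hw he, pow_one,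
    Ideal.absNorm_apply, Ideal.absNorm_apply, Submodule.cardQuot_apply, Submodule.cardQuot_apply] at h
  exact h.symm

include hw he in
/-- **`[𝔭_w^m : 𝔭_w^{m+k}] = q_v^k`** at a ramified CM place (`q_v = #(𝓞_{L⁺} ∕ v)`, `f(w|v) = 1`): for additive subgroups `B = {|x| ≤ exp(−(m+k))}`, `B′ = {|x| ≤ exp(−m)}` of `L_w`,
`B.relIndex B′ = q_v ^ k` — ★ `relIndex_ball_eq_pow` with `n = 1` over `L_w`, transported along `(Fin 1 → L_w) →+ L_w`, `f ↦ f 0`. [cite: Serre1979, Ch. II §3 Prop. 5] [cite: NeukirchANT1999, Ch. I §8] -/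
theorem relIndex_valued_le_eq_pow (m : ℤ) (k : ℕ) (B B' : AddSubgroup (w.1.adicCompletion L))
    (hB : ∀ x, x ∈ B ↔ Valued.v x ≤ WithZero.exp (-(m + k))) (hB' : ∀ x, x ∈ B' ↔ Valued.v x ≤ WithZero.exp (-m)) :
    B.relIndex B' = Nat.card (𝓞 ↥(maximalRealSubfield L) ⧸ v.asIdeal) ^ k := by
  classical
  -- the balls in `Fin 1 → L_w`
  obtain ⟨C, hC⟩ := exists_addSubgroup_ball L w.1 (n := 1) (fun _ => m + k)
  obtain ⟨C', hC'⟩ := exists_addSubgroup_ball L w.1 (n := 1) (fun _ => m)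
  have hidx := relIndex_ball_eq_pow L w.1 (n := 1) (fun _ => m) (fun _ => k) C C' hC hC'
  simp only [Finset.univ_unique, Fin.default_eq_zero, Finset.sum_singleton] at hidx
  -- transport along `f ↦ f 0`
  let φ : (Fin 1 → w.1.adicCompletion L) →+ w.1.adicCompletion L := Pi.evalAddMonoidHom (fun _ => w.1.adicCompletion L) 0
  have hφ : ∀ f : Fin 1 → w.1.adicCompletion L, φ f = f 0 := fun f => rfl
  have hcomap : B.comap φ = C := by
    ext f
    rw [AddSubgroup.mem_comap, hB, hC, hφ]
    constructor
    · intro h i; rw [Subsingleton.elim i 0]; exact_mod_cast h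
    · intro h; exact_mod_cast h 0
  have hmap : C'.map φ = B' := by
    ext x
    rw [AddSubgroup.mem_map, hB']
    constructor
    · rintro ⟨f, hf, rfl⟩; rw [hφ]; exact (hC' f).1 hf 0
    · intro hx; exact ⟨fun _ => x, (hC' _).2 fun _ => hx, rfl⟩
  rw [← natCard_quotient_placesOver_eq_of_ramified L v w hw he, ← hidx, ← hcomap, AddSubgroup.relIndex_comap, hmap]

include hw he in
/-- **THE DIFFERENT NUMBER AS AN INDEX: `[𝒪_w^# : 𝒪_w] = q_v^d`** (`N(𝔇_{w∕v}) = q_v^d`).  For a uniformiser `τ` with `|στ − τ| = exp(−d)` and additive subgroups `Λ = 𝒪_w = {|x| ≤ 1}`,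
`Λ′ = 𝒪_w^# = {|y| · |στ − τ| ≤ 1}` (the trace dual — this `hΛ'` letter is VERBATIM the right-hand side of ★ `RamifiedPlaceTraceDual.forall_valued_add_galAdicCompletionMap_mul_le_one_iff`
and of ★ `QuadraticLocalTracePlace.forall_valued_trace_mul_le_one_iff_valued_mul_le_one`, so the dual-index sequel docks by `Iff.rfl`): `Λ.relIndex Λ′ = q_v ^ d`. [cite: Serre1979, Ch. III §3 Prop. 7, Ch. III §6 Cor. 2] [cite: NeukirchANT1999, Ch. III §2] -/
theorem relIndex_integer_traceDual_eq_pow {τ : w.1.adicCompletion L} {d : ℕ}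
    (hd : Valued.v (galAdicCompletionMap (L := L) (IsCMField.complexConj L) hw τ - τ) = WithZero.exp (-(d : ℤ))) (Λ Λ' : AddSubgroup (w.1.adicCompletion L))
    (hΛ : ∀ x, x ∈ Λ ↔ Valued.v x ≤ 1) (hΛ' : ∀ y, y ∈ Λ' ↔ Valued.v y * Valued.v (galAdicCompletionMap (L := L) (IsCMField.complexConj L) hw τ - τ) ≤ 1) :
    Λ.relIndex Λ' = Nat.card (𝓞 ↥(maximalRealSubfield L) ⧸ v.asIdeal) ^ d := by
  refine relIndex_valued_le_eq_pow L v w hw he (-(d : ℤ)) d Λ Λ' (fun x => by rw [hΛ, neg_add_cancel, neg_zero, WithZero.exp_zero]) fun y => ?_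
  rw [hΛ', hd, neg_neg]
  constructor
  · intro h
    calc Valued.v y = Valued.v y * WithZero.exp (-(d : ℤ)) * WithZero.exp (d : ℤ) := by rw [mul_assoc, ← WithZero.exp_add, neg_add_cancel, WithZero.exp_zero, mul_one]
      _ ≤ 1 * WithZero.exp (d : ℤ) := by gcongr
      _ = WithZero.exp (d : ℤ) := one_mul _
  · intro h
    calc Valued.v y * WithZero.exp (-(d : ℤ)) ≤ WithZero.exp (d : ℤ) * WithZero.exp (-(d : ℤ)) := by gcongr
      _ = 1 := by rw [← WithZero.exp_add, add_neg_cancel, WithZero.exp_zero]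

/-! ## §3 The additive Mars index `[𝒪_w : 𝒪_v + ϖ_v^j 𝒪_w] = q_v^j` -/

include he in
/-- **THE ADDITIVE MARS INDEX `[𝒪_w : 𝒪_v + ϖ_v^j 𝒪_w] = q_v^j`.**  For a uniformiser `τ` (`D = |στ − τ|`) and additive subgroups `Λ = 𝒪_w = {|x| ≤ 1}`,
`O = O_j = {|x| ≤ 1, |σx − x| ≤ exp(−2j)·D}` (the conductor-`j` order, ★ σ-DEPTH `valued_galAdicCompletionMap_sub_self_le_iff_mem_order`): `O.relIndex Λ = q_v ^ j`.  PROOF: in the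
Eisenstein coordinates `x = ι a + ι b·τ` (★ basis; coordinates unique by ★ MARS `eq_of_toPlace_add_toPlace_mul_eq`) `𝒪_w ↔ {|a| ≤ 1, |b| ≤ 1}` and `O_j ↔ {|a| ≤ 1, |b| ≤ exp(−j)}`
(★ σ-DEPTH §2), so the index is ★ `relIndex_ball_eq_pow` in `L⁺_v²` with `e = 0`, `k = (0, j)`, transported by Mathlib `AddSubgroup.relIndex_comap`.
[cite: NeukirchANT1999, Ch. I §12] [cite: Flicker1998UnitaryFL, Prop. 7 p. 84] [cite: Serre1979, Ch. II §3 Prop. 5] -/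
theorem relIndex_order_eq_pow {τ : w.1.adicCompletion L} (hτ : Valued.v τ = WithZero.exp (-1 : ℤ)) (j : ℕ) (Λ O : AddSubgroup (w.1.adicCompletion L))
    (hΛ : ∀ x, x ∈ Λ ↔ Valued.v x ≤ 1)
    (hO : ∀ x, x ∈ O ↔ Valued.v x ≤ 1 ∧ Valued.v (galAdicCompletionMap (L := L) (IsCMField.complexConj L) hw x - x) ≤
      WithZero.exp (-(2 * j : ℤ)) * Valued.v (galAdicCompletionMap (L := L) (IsCMField.complexConj L) hw τ - τ)) :
    O.relIndex Λ = Nat.card (𝓞 ↥(maximalRealSubfield L) ⧸ v.asIdeal) ^ j := by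
  classical
  -- the balls `{|a| ≤ 1, |b| ≤ exp(-j)}` and `{|a| ≤ 1, |b| ≤ 1}` in `L⁺_v²`
  obtain ⟨C, hC⟩ := exists_addSubgroup_ball ↥(maximalRealSubfield L) v (n := 2) (fun i => (0 : ℤ) + (![0, j] i : ℕ))
  obtain ⟨C', hC'⟩ := exists_addSubgroup_ball ↥(maximalRealSubfield L) v (n := 2) (fun _ => (0 : ℤ))
  have hidx := relIndex_ball_eq_pow ↥(maximalRealSubfield L) v (n := 2) (fun _ => (0 : ℤ)) ![0, j] C C' hC hC'
  simp only [Fin.sum_univ_two, Matrix.cons_val_zero, Matrix.cons_val_one, zero_add] at hidx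
  -- the coordinate hom `(a, b) ↦ ι a + ι b τ`
  let φ : (Fin 2 → v.adicCompletion ↥(maximalRealSubfield L)) →+ w.1.adicCompletion L :=
    { toFun := fun f => toPlace v w (f 0) + toPlace v w (f 1) * τ
      map_zero' := by simp
      map_add' := fun f g => by simp only [Pi.add_apply, map_add]; ring }
  have hφ : ∀ f : Fin 2 → v.adicCompletion ↥(maximalRealSubfield L), φ f = toPlace v w (f 0) + toPlace v w (f 1) * τ := fun f => rfl
  have hmem2 : ∀ f : Fin 2 → v.adicCompletion ↥(maximalRealSubfield L),
      (∀ i, Valued.v (f i) ≤ WithZero.exp (-((0 : ℤ) + (![0, j] i : ℕ)))) ↔ Valued.v (f 0) ≤ 1 ∧ Valued.v (f 1) ≤ WithZero.exp (-(j : ℤ)) := fun f => by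
    constructor
    · intro h
      refine ⟨?_, ?_⟩
      · have h0 := h 0; simp only [Matrix.cons_val_zero, Nat.cast_zero, add_zero, neg_zero, WithZero.exp_zero] at h0; exact h0
      · have h1 := h 1; simp only [Matrix.cons_val_one, Matrix.cons_val_zero, zero_add] at h1; exact h1
    · rintro ⟨h0, h1⟩ i
      fin_cases i
      · simp only [Fin.zero_eta, Matrix.cons_val_zero, Nat.cast_zero, add_zero, neg_zero, WithZero.exp_zero]; exact h0
      · simp only [Fin.mk_one, Matrix.cons_val_one, Matrix.cons_val_zero, zero_add]; exact h1
  have hmem0 : ∀ f : Fin 2 → v.adicCompletion ↥(maximalRealSubfield L),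
      (∀ i, Valued.v (f i) ≤ WithZero.exp (-(0 : ℤ))) ↔ Valued.v (f 0) ≤ 1 ∧ Valued.v (f 1) ≤ 1 := fun f => by
    simp only [neg_zero, WithZero.exp_zero, Fin.forall_fin_two]
  -- integrality in coordinates (★ basis) and the order in coordinates (★ σ-DEPTH §2)
  have hint : ∀ p q : v.adicCompletion ↥(maximalRealSubfield L), Valued.v (toPlace v w p + toPlace v w q * τ) ≤ 1 ↔ Valued.v p ≤ 1 ∧ Valued.v q ≤ 1 := fun p q => by
    rw [valued_toPlace_add_toPlace_mul L v w hw he hτ, max_le_iff, sq_le_one_iff_withZero, sq_mul_exp_neg_one_le_one_iff]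
  have hj1 : WithZero.exp (-(j : ℤ)) ≤ 1 := by rw [← WithZero.exp_zero, WithZero.exp_le_exp]; omega
  have hΛφ : ∀ f : Fin 2 → v.adicCompletion ↥(maximalRealSubfield L), φ f ∈ Λ ↔ Valued.v (f 0) ≤ 1 ∧ Valued.v (f 1) ≤ 1 := fun f => by
    rw [hΛ, hφ, hint]
  have hOφ : ∀ f : Fin 2 → v.adicCompletion ↥(maximalRealSubfield L), φ f ∈ O ↔ Valued.v (f 0) ≤ 1 ∧ Valued.v (f 1) ≤ WithZero.exp (-(j : ℤ)) := fun f => by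
    rw [hO, hφ, hint, ← exp_neg_sq, valued_galAdicCompletionMap_sub_self_le_sq_mul_iff L v w hw he hτ]
    constructor
    · rintro ⟨⟨h0, -⟩, h1⟩; exact ⟨h0, h1⟩
    · rintro ⟨h0, h1⟩; exact ⟨⟨h0, h1.trans hj1⟩, h1⟩
  -- `O.comap φ = C`
  have hcomap : O.comap φ = C := by
    ext f
    rw [AddSubgroup.mem_comap, hOφ, hC, hmem2]
  -- `C'.map φ = Λ`
  have hmap : C'.map φ = Λ := by
    ext x
    rw [AddSubgroup.mem_map]
    constructor
    · rintro ⟨f, hf, rfl⟩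
      exact (hΛφ f).2 ((hmem0 f).1 ((hC' f).1 hf))
    · intro hx
      obtain ⟨p, q, rfl⟩ := exists_eq_toPlace_add_toPlace_mul L v w hw he hτ x
      refine ⟨![p, q], (hC' _).2 ((hmem0 _).2 ?_), by rw [hφ]; rfl⟩
      simp only [Matrix.cons_val_zero, Matrix.cons_val_one]
      exact (hΛφ ![p, q]).1 hx
  rw [← hidx, ← hcomap, AddSubgroup.relIndex_comap, hmap]

include he in
/-- The additive Mars index read with the residue field of the completion: `[𝒪_w : 𝒪_v + ϖ_v^j 𝒪_w] = #𝓀(L⁺_v) ^ j` (★ `natCard_residueField_valuativeRel_eq`).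
[cite: NeukirchANT1999, Ch. I §12] [cite: Flicker1998UnitaryFL, Prop. 7 p. 84] -/
theorem relIndex_order_eq_natCard_residueField_pow {τ : w.1.adicCompletion L} (hτ : Valued.v τ = WithZero.exp (-1 : ℤ)) (j : ℕ) (Λ O : AddSubgroup (w.1.adicCompletion L))
    (hΛ : ∀ x, x ∈ Λ ↔ Valued.v x ≤ 1)
    (hO : ∀ x, x ∈ O ↔ Valued.v x ≤ 1 ∧ Valued.v (galAdicCompletionMap (L := L) (IsCMField.complexConj L) hw x - x) ≤
      WithZero.exp (-(2 * j : ℤ)) * Valued.v (galAdicCompletionMap (L := L) (IsCMField.complexConj L) hw τ - τ)) :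
    O.relIndex Λ = Nat.card 𝓀[v.adicCompletion ↥(maximalRealSubfield L)] ^ j := by
  rw [relIndex_order_eq_pow L v w hw he hτ j Λ O hΛ hO, natCard_residueField_valuativeRel_eq]

include he in
/-- The additive Mars index with the different number as a binder (MARS's `…_exp_neg` letters): for `|στ − τ| = exp(−d)` and `O = {|x| ≤ 1, |σx − x| ≤ exp(−(d + 2j))}`,
`O.relIndex Λ = #𝓀(L⁺_v) ^ j`. [cite: NeukirchANT1999, Ch. I §12] [cite: Flicker1998UnitaryFL, Prop. 7 p. 84] -/
theorem relIndex_order_eq_pow_exp_neg {τ : w.1.adicCompletion L} (hτ : Valued.v τ = WithZero.exp (-1 : ℤ)) {d : ℕ}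
    (hd : Valued.v (galAdicCompletionMap (L := L) (IsCMField.complexConj L) hw τ - τ) = WithZero.exp (-(d : ℤ))) (j : ℕ) (Λ O : AddSubgroup (w.1.adicCompletion L))
    (hΛ : ∀ x, x ∈ Λ ↔ Valued.v x ≤ 1)
    (hO : ∀ x, x ∈ O ↔ Valued.v x ≤ 1 ∧ Valued.v (galAdicCompletionMap (L := L) (IsCMField.complexConj L) hw x - x) ≤ WithZero.exp (-((d + 2 * j : ℕ) : ℤ))) :
    O.relIndex Λ = Nat.card 𝓀[v.adicCompletion ↥(maximalRealSubfield L)] ^ j := by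
  refine relIndex_order_eq_natCard_residueField_pow L v w hw he hτ j Λ O hΛ fun x => ?_
  rw [hO x, hd, ← WithZero.exp_add]
  push_cast
  rw [show -(2 * (j : ℤ)) + -(d : ℤ) = -((d : ℤ) + 2 * j) by ring]

end Literature.NumberTheory.Automorphic.UnitaryGroup

end
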